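import Literature.AlgebraicGeometry.ShimuraVarieties.UnitaryCurveAuxiliaryComplexStructure
import Literature.AlgebraicGeometry.ShimuraVarieties.UnitaryAuxiliaryComplexStructureInjective
import HarnessLib

/-!
# The frame-free complex structure `J_Φ(v)` determines the negative LINE `ℂv`, IN ANY RANK `n`
# ([Deligne 1979] Prop. 2.3.10 — bookkeeping for [Deligne 1971] Prop. 1.15: the layers of the symplectic embedding separate lines)

Topic `AlgebraicGeometry/ShimuraVarieties`; namespace `Literature.AlgebraicGeometry.ShimuraVarieties.UnitaryCurve.AuxV`.
THEOREMS ONLY (no definition, no named fact, no instance, no notation, no `sorry`; net debt 0).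
Cell `hodgecm-mathlib` (D-0151), FLOOR 0, P6 «MOD programme», door (E) of `stub_RGD`, organ **E2 FILE A5** (census
`F0/P6/A-p17/g27/CENSUS-E2-UnitaryCurveAuxiliaryPeriodMap.v1.A-p17g27.md`, split 2026-09-01T21:58:07Z «(J-inj)»; second hand A-p14 (g33)):
the rank-`n`, `W₀`-FREE and FRAME-FREE twin of ★ `UnitaryAuxiliaryComplexStructureInjective` (rank 3, ball model, frame `T`), over ★ E2
FILE A1 `UnitaryCurveAuxiliaryLineReflection` (`formH`, `projH`, `reflH`), ★ A2 `UnitaryCurveAuxiliaryComplexStructure` (`sCompV`, `sMatV`,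
`sPhiV`, `auxComplexStructureVGL`, `auxComplexStructureV`), ★ E1 `UnitaryCurveAuxiliarySymplecticModuleV` (`auxRepV = conjRect ∘ resGL ∘ blockGLV`)
and the rank-free injectivity layers of ★ `UnitaryAuxiliaryComplexStructureInjective` (`resGL_injective`, `conjRect_injective`,
`exists_ringHom_comp_eq`).  It supplies the hypothesis `hJinj` of ★ E3 `UnitaryCurveSiegelPointSeparation` with `J := auxComplexStructureV F τ Φ`.
`--supports stmt-HodgeConjecture-24832`, count-neutral; HC_CM is proved only modulo the printed citations until rung 0 closes.

The argument (every step PROVED here):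
* §1 `smul_coe_injective` (`t·X = t·X′ ⇒ X = X′` for a unit scalar `t`), **`auxRepV_snd_injective`**: `auxRepV R β (t, X) = auxRepV R β (t, X′) ⇒
  X = X′` — with the `W₀`-free block `blockGLV (t, X) = t·X` the pair map is NOT injective (`(tc, c⁻¹X)`), but at a FIXED torus part it is
  (conjugation by the frame and restriction of scalars are injective, ★ `conjRect_injective`, ★ `resGL_injective`); hence
  `sPhiV_eq_of_auxComplexStructureV_eq`: `J_Φ(v) = J_Φ(v′) ⇒ s_v = s_{v′}`.
* §2 the eigenline lemma `exists_eq_smul_of_reflH_mulVec_eq_neg` (`r_w y = −y ⇒ y ∈ ℂw`, from ★ `reflH_mulVec`), `reflH_eq_of_sMatV_eq` (at an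
  embedding `ρ ∈ Φ` over `τ`, which exists by ★ `exists_ringHom_comp_eq` and lies in `Φ` under ★ `IsExtAdapted τ j Φ`, the `ρ`-component of `s_v` is
  `r_v`, ★ `sCompV_of_eq`), and **`exists_smul_eq_of_auxComplexStructureV_eq`**: for `v′` NEGATIVE, `J_Φ(v) = J_Φ(v′) ⇒ ∃ c ≠ 0, c • v′ = v`
  (`r_v v′ = r_{v′} v′ = −v′`, so `v′ ∈ ℂv`); the E3-shaped export **`auxComplexStructureV_hJinj`**.

## References
* [Deligne1979ShimuraVarieties] P. Deligne, *Variétés de Shimura* (1979), Prop. 2.3.10 (PDF p. 32 of Milne's translation).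
* [Deligne1971TravauxShimura] P. Deligne, *Travaux de Shimura*, Sém. Bourbaki 389 (1971), 4.9 p. 148, Prop. 1.15 p. 132.
* [Milne2005ShimuraVarieties] J. S. Milne, *Introduction to Shimura varieties* (2005), §6 pp. 67–68.
* [RapoportSmithlingZhang2020Diagonal] M. Rapoport, B. Smithling, W. Zhang, Compos. Math. 156 (2020), Remark 3.2 (ii)(iii), Remark 3.3 p. 10.
-/

set_option autoImplicit false

noncomputable section

open Matrix NumberField
open scoped TensorProduct

namespace Literature.AlgebraicGeometry.ShimuraVarieties

namespace UnitaryCurve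

namespace AuxV

open Literature.AlgebraicGeometry.ModuliOfAbelianVarieties
open Literature.AlgebraicGeometry.Motives (CMType)
open Literature.AlgebraicGeometry.ShimuraVarieties.UnitaryCanonicalModel.Aux (IsExtAdapted realEmb ratBasis iPhi resGL_injective
  conjRect_injective exists_ringHom_comp_eq)

/-! ### §1. Injectivity of `auxRepV` at a fixed torus part -/

section Injective

/-- `t·X = t·X′ ⇒ X = X′` for a unit scalar `t` (the `W₀`-free block `blockGLV (t, ·)` is injective at FIXED `t`).
[cite: RapoportSmithlingZhang2020Diagonal, Remark 3.2 (ii)(iii) pp. 9–10] -/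
theorem blockGLV_snd_injective (S : Type) [CommRing S] {n : ℕ} (t : Sˣ) :
    Function.Injective fun X : GL (Fin n) S => blockGLV S (t, X) := by
  intro X X' h
  have hm := congrArg (fun u : GL (Fin n) S => ((t⁻¹ : Sˣ) : S) • (u : Matrix (Fin n) (Fin n) S)) h
  simp only [coe_blockGLV, smul_smul, Units.inv_mul, one_smul] at hm
  exact Units.ext hm

variable {L : Type} [Field L] {M : Type} [Field M] [NumberField M] [IsCMField M] {j : L →+* M}
  {n : ℕ} {H : Matrix (Fin n) (Fin n) L} {ξ : M} {g : ℕ} {δ : Fin g → ℕ}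

/-- **The similitude representation `auxRepV R β` is injective at a fixed torus part**: `auxRepV R β (t, X) = auxRepV R β (t, X′) ⇒ X = X′`
(conjugation by the frame ★ `conjRect_injective`, restriction of scalars ★ `resGL_injective`, and `blockGLV_snd_injective`).
[cite: Deligne1979ShimuraVarieties, Prop. 2.3.10 (PDF p. 32)] [cite: Deligne1971TravauxShimura, 4.9 p. 148] -/
theorem auxRepV_snd_injective (R : Type) [CommRing R] [Algebra ℚ R] (F : SymplecticFrameV M j H ξ g δ) (t : (R ⊗[ℚ] M)ˣ)
    {X X' : GL (Fin n) (R ⊗[ℚ] M)} (h : auxRepV R F (t, X) = auxRepV R F (t, X')) : X = X' := by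
  have h1 := conjRect_injective (framePVR R F) (frameQVR R F) (framePVR_mul_frameQVR R F) (frameQVR_mul_framePVR R F) h
  have h2 := resGL_injective (m := Fin n) (Algebra.TensorProduct.basis R (ratBasis M)) h1
  exact blockGLV_snd_injective (R ⊗[ℚ] M) t h2

variable (F : SymplecticFrameV M j H ξ g δ) (τ : L →+* ℂ) (Φ : CMType M)

/-- **`J_Φ(v) = J_Φ(v′) ⇒ s_v = s_{v′}`** (the torus part `iPhi` is the same on both sides). [cite: Deligne1979ShimuraVarieties, Prop. 2.3.10 (PDF p. 32)] -/
theorem sPhiV_eq_of_auxComplexStructureV_eq {v v' : Fin n → ℂ} (h : auxComplexStructureV F τ Φ v = auxComplexStructureV F τ Φ v') :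
    sPhiV M j Φ τ H v = sPhiV M j Φ τ H v' := by
  have hGL : auxComplexStructureVGL F τ Φ v = auxComplexStructureVGL F τ Φ v' := Units.ext h
  exact auxRepV_snd_injective ℝ F (iPhi M Φ) hGL

/-- `J_Φ(v) = J_Φ(v′) ⇒ sMatV v = sMatV v′`. [cite: Deligne1979ShimuraVarieties, Prop. 2.3.10 (PDF p. 32)] -/
theorem sMatV_eq_of_auxComplexStructureV_eq {v v' : Fin n → ℂ} (h : auxComplexStructureV F τ Φ v = auxComplexStructureV F τ Φ v') :
    sMatV M j Φ τ H v = sMatV M j Φ τ H v' := by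
  have hs := congrArg (fun u : GL (Fin n) (ℝ ⊗[ℚ] M) => (u : Matrix (Fin n) (Fin n) (ℝ ⊗[ℚ] M)))
    (sPhiV_eq_of_auxComplexStructureV_eq F τ Φ h)
  simpa only [coe_sPhiV] using hs

end Injective

/-! ### §2. The complex structure determines the negative line -/

section Line

variable {m : Type} [Fintype m] [DecidableEq m] {Hc : Matrix m m ℂ}

/-- **The `−1`-eigenvectors of the reflection `r_w` lie on the line `ℂw`**: `r_w y = −y ⇒ y = c·w` (`r_w y = y − 2·((w̄ᵀHc y)/q(w))·w`, ★ `reflH_mulVec`).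
[cite: Deligne1979ShimuraVarieties, Prop. 2.3.10 (PDF p. 32)] [cite: RapoportSmithlingZhang2020Diagonal, Remark 3.3 p. 10] -/
theorem exists_eq_smul_of_reflH_mulVec_eq_neg {w y : m → ℂ} (h : reflH Hc w *ᵥ y = -y) : ∃ c : ℂ, y = c • w := by
  set c : ℂ := (2 : ℂ) * ((formH Hc w)⁻¹ * (star w ⬝ᵥ (Hc *ᵥ y))) with hc
  rw [reflH_mulVec] at h
  refine ⟨(2 : ℂ)⁻¹ * c, ?_⟩
  have h2 : (2 : ℂ) • y = c • w := by
    rw [two_smul]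
    calc y + y = y - c • w + y + c • w := by abel
      _ = -y + y + c • w := by rw [h]
      _ = c • w := by abel
  have h3 := congrArg (fun z : m → ℂ => (2 : ℂ)⁻¹ • z) h2
  simp only [smul_smul, inv_mul_cancel₀ (two_ne_zero' ℂ), one_smul] at h3
  exact h3

variable {L : Type} [Field L] [CharZero L] {M : Type} [Field M] [NumberField M] [IsCMField M] {j : L →+* M}
  {n : ℕ} {H : Matrix (Fin n) (Fin n) L} {ξ : M} {g : ℕ} {δ : Fin g → ℕ}
  (F : SymplecticFrameV M j H ξ g δ) (τ : L →+* ℂ) (Φ : CMType M)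

omit [IsCMField M] in
/-- At an embedding `ρ ∈ Φ` over `τ` — one exists (★ `exists_ringHom_comp_eq`) and lies in `Φ` under ★ `IsExtAdapted τ j Φ` — the `ρ`-component of
`s_v` is the `H^τ`-reflection `r_v`; so `sMatV v = sMatV v′ ⇒ r_v = r_{v′}`. [cite: Deligne1979ShimuraVarieties, Prop. 2.3.10 and 2.3.9 (PDF p. 32)] -/
theorem reflH_eq_of_sMatV_eq (hΦ : IsExtAdapted τ j Φ) {v v' : Fin n → ℂ} (h : sMatV M j Φ τ H v = sMatV M j Φ τ H v') :
    reflH (H.map τ) v = reflH (H.map τ) v' := by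
  obtain ⟨ρ, hρ⟩ := exists_ringHom_comp_eq j τ
  let ρ' : Φ.1 := ⟨ρ, hΦ ρ hρ⟩
  have hcomp : ρ'.1.comp j = τ := hρ
  have hmap := congrArg (fun A : Matrix (Fin n) (Fin n) (ℝ ⊗[ℚ] M) => A.map (realEmb M Φ ρ')) h
  simpa only [sMatV_map_realEmb, sCompV_of_eq _ hcomp] using hmap

/-- **(J-inj) The complex structure determines the negative line**: under `IsExtAdapted τ j Φ`, for `v′` NEGATIVE for `H^τ`,
`J_Φ(v) = J_Φ(v′) ⇒ ∃ c ≠ 0, c • v′ = v` (`s_v = s_{v′}`, so `r_v = r_{v′}` at an embedding over `τ`; then `r_v v′ = r_{v′} v′ = −v′` puts `v′` on the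
line `ℂv`, and `v′ ≠ 0`). [cite: Deligne1979ShimuraVarieties, Prop. 2.3.10 (PDF p. 32)] [cite: Milne2005ShimuraVarieties, §6 p. 68]
[cite: RapoportSmithlingZhang2020Diagonal, Remark 3.3 p. 10] -/
theorem exists_smul_eq_of_auxComplexStructureV_eq (hΦ : IsExtAdapted τ j Φ) {v v' : Fin n → ℂ} (hv' : v' ∈ negCone (H.map τ))
    (h : auxComplexStructureV F τ Φ v = auxComplexStructureV F τ Φ v') : ∃ c : ℂ, c ≠ 0 ∧ c • v' = v := by
  have hr : reflH (H.map τ) v = reflH (H.map τ) v' := reflH_eq_of_sMatV_eq τ Φ hΦ (sMatV_eq_of_auxComplexStructureV_eq F τ Φ h)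
  have hneg : reflH (H.map τ) v *ᵥ v' = -v' := by
    rw [hr]
    exact reflH_mulVec_self (H.map τ) (formH_ne_zero_of_mem_negCone (H.map τ) hv')
  obtain ⟨c, hc⟩ := exists_eq_smul_of_reflH_mulVec_eq_neg hneg
  have hc0 : c ≠ 0 := by
    rintro rfl
    rw [zero_smul] at hc
    exact ne_zero_of_mem_negCone (H.map τ) hv' hc
  refine ⟨c⁻¹, inv_ne_zero hc0, ?_⟩
  rw [hc, smul_smul, inv_mul_cancel₀ hc0, one_smul]

/-- **(J-inj) in the binder shape of ★ E3** (`UnitaryCurveSiegelPointSeparation`: the hypothesis `hJinj` with `J := auxComplexStructureV F τ Φ`).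
[cite: Deligne1979ShimuraVarieties, Prop. 2.3.10 (PDF p. 32)] [cite: Deligne1971TravauxShimura, Prop. 1.15 p. 132] -/
theorem auxComplexStructureV_hJinj (hΦ : IsExtAdapted τ j Φ) :
    ∀ v : Fin n → ℂ, v ∈ negCone (H.map τ) → ∀ v' : Fin n → ℂ, v' ∈ negCone (H.map τ) →
      auxComplexStructureV F τ Φ v = auxComplexStructureV F τ Φ v' → ∃ c : ℂ, c ≠ 0 ∧ c • v' = v :=
  fun _ _ _ hv' h => exists_smul_eq_of_auxComplexStructureV_eq F τ Φ hΦ hv' h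

/-- **Injectivity on lines**: `J_Φ` is injective on the negative cone MODULO `ℂˣ` — together with ★ `auxComplexStructureV_smul` (`J_Φ(c • v) = J_Φ(v)`),
`J_Φ(v) = J_Φ(v′) ↔ ℂv = ℂv′` for negative `v, v′`. [cite: Deligne1979ShimuraVarieties, Prop. 2.3.10 (PDF p. 32)] [cite: RapoportSmithlingZhang2020Diagonal, Remark 3.3 p. 10] -/
theorem auxComplexStructureV_eq_iff (hΦ : IsExtAdapted τ j Φ) {v v' : Fin n → ℂ} (hv' : v' ∈ negCone (H.map τ)) :
    auxComplexStructureV F τ Φ v = auxComplexStructureV F τ Φ v' ↔ ∃ c : ℂ, c ≠ 0 ∧ c • v' = v := by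
  refine ⟨exists_smul_eq_of_auxComplexStructureV_eq F τ Φ hΦ hv', ?_⟩
  rintro ⟨c, hc, rfl⟩
  exact auxComplexStructureV_smul F τ Φ v' hc

end Line

end AuxV

end UnitaryCurve

end Literature.AlgebraicGeometry.ShimuraVarieties

end
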